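import Mathlib
import Literature.Analysis.SpecialFunctions.GaussLegendreQuadrature
import Literature.Analysis.Quadrature.ChebyshevCoefficients
import Literature.Analysis.Quadrature.GaussLegendreAliasing

/-!
# Gauss–Legendre quadrature for integrands with a derivative of bounded variation (Trefethen 2008, Thm. 4.5 (4.13))

**Theorem** [cite: Trefethen2008, Thm. 4.5 (4.13)] (p. 75 loc. cit.; Trefethen writes the rule
with `n + 1` nodes `x_0, …, x_n`, here `N` is the NUMBER OF NODES as in `gaussLegendreNodes N`, so
his `n` is `N - 1`): *let Gauss quadrature be applied to `f ∈ C[-1, 1]`.  If `f, f', …, f^{(k-1)}`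
are absolutely continuous on `[-1, 1]` and `‖f^{(k)}‖_T = V < ∞` for some `k ≥ 1`, where
`‖u‖_T = ‖u'(x) / √(1 - x²)‖_1` ((4.5) loc. cit.), then for each `n ≥ k/2`,*
`|I - I_n| ≤ 64 V / (15 π k (2n + 1 - k)^k)`, *i.e., with `N = n + 1` nodes and `k ≤ 2N - 2`,*
`|∫_{-1}^{1} f(x) dx - Σ_x w_x f(x)| ≤ 64 V / (15 π k (2N - 1 - k)^k)`.

## What is formalised (hypothesis class)

As in `ChebyshevCoefficients`: a chain `F 0 = f, F 1, …, F k, F (k+1) : ℝ → ℂ` with `F i`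
continuous on `[-1, 1]` and `F (i+1)` the derivative of `F i` at every point of `(-1, 1)` off a
fixed countable set `s` (`i ≤ k`), and `θ ↦ F (k+1) (cos θ)` integrable on `[0, π]`; the bound
holds with `V := ∫_0^π |F (k+1) (cos θ)| dθ` (`= ∫_{-1}^{1} |f^{(k+1)}(x)| (1-x²)^{-1/2} dx`, which
is `‖f^{(k)}‖_T` for such `f`).  This covers `f^{(k)}` continuous and piecewise `C¹` with
Chebyshev-weight-integrable `f^{(k+1)}` — in particular `f ∈ C^{k+1}` with `|f^{(k+1)}| ≤ S`,
where `V ≤ π S` (`norm_integral_sub_gaussLegendre_le_interval_of_contDiff`).  The Stieltjes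
generality of (4.5) (`f^{(k)}` merely of bounded variation, jumps allowed) is NOT formalised.

* `norm_integral_sub_gaussLegendre_le_descFactorial_of_hasDerivAt`: the form the proof gives,
  `64 V / (15 π k (2N-1)(2N-2)⋯(2N-k))`;
* `norm_integral_sub_gaussLegendre_le_of_hasDerivAt`: (4.13) as displayed (re-indexed to `N`);
* `norm_integral_sub_gaussLegendre_le_interval_of_hasDerivAt`: on `[a, b]` — nodes
  `(b-a)/2 · x + (a+b)/2`, weights `(b-a)/2 · w_x`, bound `(b-a)/2 · 64 V_g / (15 π k (2N-1-k)^k)`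
  with `V_g = ((b-a)/2)^{k+1} ∫_0^π |f^{(k+1)}((b-a)/2 cos θ + (a+b)/2)| dθ` the quantity `V` of the
  transplanted `g(t) = f((b-a)/2 t + (a+b)/2)`;
* `norm_integral_sub_gaussLegendre_le_interval_of_contDiff`: `f ∈ C^{k+1}(ℝ)`,
  `|f^{(k+1)}| ≤ S` on `[a, b]`: bound `(b-a)/2 · 64 (π ((b-a)/2)^{k+1} S) / (15 π k (2N-1-k)^k)`.

Proof, as loc. cit.: the coefficient bound (4.6) (`norm_chebCoeff_le_of_hasDerivAt`) from the first
aliased index `j = 2N ≥ k + 2` on, the aliasing lemma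
(`norm_integral_sub_gaussLegendre_le_of_chebCoeff_le`, constant `32/15` since `N ≥ 2`), the
telescoped tail `Σ_{j ≥ 2N} 1/(j (j-1) ⋯ (j-k)) ≤ 1 / (k (2N-1) ⋯ (2N-k))`
(`tsum_one_div_descFactorial_le`; (4.10) loc. cit. uses an integral instead), and finally
`(2N-1) ⋯ (2N-k) ≥ (2N-k)^k ≥ (2N-1-k)^k`.

The companion bound (4.14) for analytic integrands is `GaussLegendreAnalytic` (independent file).

## References

* L. N. Trefethen, *Is Gauss quadrature better than Clenshaw–Curtis?*, SIAM Review **50** (2008)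
  67–87, Thm. 4.5, eq. (4.13); Thms. 4.2–4.3, 5.1. [cite: Trefethen2008, Thm. 4.5 (4.13)]

AI-produced formalisation (H21 engines group, seat eng-quad-3, 2026-08-20); no facts, no axioms
beyond Mathlib's, no `sorry`.
-/

open Set MeasureTheory Filter

open scoped Real Interval

namespace Literature.Analysis.Quadrature

open Literature.Analysis.SpecialFunctions

/-! ### Theorem 4.5 (4.13) on `[-1, 1]` -/

/-- **Trefethen 2008, Thm. 4.5 (4.13), product form.**  For the `N`-point Gauss–Legendre rule,
`1 ≤ k ≤ 2N - 2`, and `f` with a derivative chain `F 0 = f, …, F (k+1)` as in the module docstring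
(`F i` continuous on `[-1, 1]`, `F (i+1) = (F i)'` on `(-1, 1)` off the countable set `s`,
`θ ↦ F (k+1) (cos θ)` integrable on `[0, π]`):
`‖∫_{-1}^{1} f - Σ_x w_x f(x)‖ ≤ 64 V / (15 π k (2N-1)(2N-2)⋯(2N-k))`, `V = ∫_0^π |F (k+1)(cos θ)| dθ`
(the bound the proof loc. cit. yields before `(2N-1)⋯(2N-k) ≥ (2N-1-k)^k`).
[cite: Trefethen2008, Thm. 4.5 (4.13)] -/
theorem norm_integral_sub_gaussLegendre_le_descFactorial_of_hasDerivAt {f : ℝ → ℂ} {k : ℕ}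
    {F : ℕ → ℝ → ℂ} {s : Set ℝ} (hs : s.Countable) (hF0 : F 0 = f)
    (hcont : ∀ i ≤ k, ContinuousOn (F i) (Icc (-1 : ℝ) 1))
    (hder : ∀ i ≤ k, ∀ x ∈ Ioo (-1 : ℝ) 1 \ s, HasDerivAt (F i) (F (i + 1) x) x)
    (hint : IntervalIntegrable (fun θ : ℝ => F (k + 1) (Real.cos θ)) volume 0 π)
    (hk : 1 ≤ k) {N : ℕ} (hN : k ≤ 2 * N - 2) :
    ‖(∫ t in (-1 : ℝ)..1, f t) -
        ∑ x ∈ gaussLegendreNodes N, (gaussLegendreWeight N x : ℂ) * f x‖ ≤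
      64 * (∫ θ in (0 : ℝ)..π, ‖F (k + 1) (Real.cos θ)‖) /
        (15 * π * k * ((2 * N - 1).descFactorial k : ℝ)) := by
  subst hF0
  have hN2 : 2 ≤ N := by omega
  have hπ := Real.pi_pos
  set V : ℝ := ∫ θ in (0 : ℝ)..π, ‖F (k + 1) (Real.cos θ)‖ with hV
  have hV0 : 0 ≤ V := intervalIntegral.integral_nonneg hπ.le fun θ _ => norm_nonneg _
  set W : ℝ := 2 / π * V with hW
  have hW0 : 0 ≤ W := by positivity
  -- integrability of the whole chain `θ ↦ F i (cos θ)`, `i ≤ k + 1`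
  have hint' : ∀ i ≤ k + 1, IntervalIntegrable (fun θ : ℝ => F i (Real.cos θ)) volume 0 π := by
    intro i hi
    rcases Nat.lt_or_ge i (k + 1) with h | h
    · exact ((hcont i (by omega)).comp_continuous Real.continuous_cos
        Real.cos_mem_Icc).intervalIntegrable _ _
    · rw [show i = k + 1 by omega]
      exact hint
  -- (4.6): `|a_j| ≤ W / (j (j-1) ⋯ (j-k))` for `j ≥ k + 1`
  have hcoef : ∀ {j : ℕ}, k + 1 ≤ j → ‖chebCoeff (F 0) j‖ ≤ W / (j.descFactorial (k + 1) : ℝ) :=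
    fun {j} hj => norm_chebCoeff_le_of_hasDerivAt hs (k + 1) (fun i hi => hcont i (by omega))
      (fun i hi => hder i (by omega)) hint' hj
  -- the summable majorant: (4.6) from the first aliased index `2N` on
  set b : ℕ → ℝ := fun j =>
    if 2 * N ≤ j then W / (j.descFactorial (k + 1) : ℝ) else ‖chebCoeff (F 0) j‖ with hb
  have hble : ∀ j, ‖chebCoeff (F 0) j‖ ≤ b j := by
    intro j
    simp only [hb]
    split_ifs with h
    · exact hcoef (by omega)
    · exact le_rfl
  have htail := tsum_one_div_descFactorial_le (M := 2 * N) hk (by omega)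
  have hbshift : ∀ i, b (i + 2 * N) = W * (1 / ((2 * N + i).descFactorial (k + 1) : ℝ)) := by
    intro i
    simp only [hb]
    rw [if_pos (by omega), show i + 2 * N = 2 * N + i by ring]
    ring
  have hbs' : Summable fun i => b (i + 2 * N) := by
    simp only [hbshift]
    exact htail.1.mul_left W
  have hbs : Summable b := (summable_nat_add_iff (2 * N)).mp hbs'
  have key := norm_integral_sub_gaussLegendre_le_of_chebCoeff_le (hcont 0 (by omega)) hble hbs hN2
  have htsum : ∑' i, b (i + 2 * N) = W * ∑' i, 1 / ((2 * N + i).descFactorial (k + 1) : ℝ) := by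
    simp only [hbshift]
    exact tsum_mul_left
  refine key.trans ?_
  rw [htsum]
  have hkpos : (0 : ℝ) < k := by exact_mod_cast hk
  have hD : (0 : ℝ) < ((2 * N - 1).descFactorial k : ℝ) := by
    exact_mod_cast Nat.descFactorial_pos.mpr (by omega)
  calc 32 / 15 * (W * ∑' i, 1 / ((2 * N + i).descFactorial (k + 1) : ℝ))
      ≤ 32 / 15 * (W * (1 / (k * ((2 * N - 1).descFactorial k : ℝ)))) := by
        gcongr
        exact htail.2
    _ = 64 * V / (15 * π * k * ((2 * N - 1).descFactorial k : ℝ)) := by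
        rw [hW]
        field_simp
        ring

/-- **Trefethen 2008, Thm. 4.5 (4.13)** (re-indexed: `N` nodes, Trefethen's `n = N - 1`).  For the
`N`-point Gauss–Legendre rule, `1 ≤ k ≤ 2N - 2` (i.e. `n ≥ k/2`), and `f` with a derivative chain
`F 0 = f, …, F (k+1)` (`F i` continuous on `[-1, 1]`, `F (i+1) = (F i)'` on `(-1, 1)` off the
countable set `s` for `i ≤ k`, `θ ↦ F (k+1) (cos θ)` integrable on `[0, π]`):
`‖∫_{-1}^{1} f(x) dx - Σ_x w_x f(x)‖ ≤ 64 V / (15 π k (2N - 1 - k)^k)`, where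
`V = ∫_0^π |F (k+1) (cos θ)| dθ = ∫_{-1}^{1} |f^{(k+1)}(x)| (1-x²)^{-1/2} dx = ‖f^{(k)}‖_T`.
[cite: Trefethen2008, Thm. 4.5 (4.13)] -/
theorem norm_integral_sub_gaussLegendre_le_of_hasDerivAt {f : ℝ → ℂ} {k : ℕ}
    {F : ℕ → ℝ → ℂ} {s : Set ℝ} (hs : s.Countable) (hF0 : F 0 = f)
    (hcont : ∀ i ≤ k, ContinuousOn (F i) (Icc (-1 : ℝ) 1))
    (hder : ∀ i ≤ k, ∀ x ∈ Ioo (-1 : ℝ) 1 \ s, HasDerivAt (F i) (F (i + 1) x) x)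
    (hint : IntervalIntegrable (fun θ : ℝ => F (k + 1) (Real.cos θ)) volume 0 π)
    (hk : 1 ≤ k) {N : ℕ} (hN : k ≤ 2 * N - 2) :
    ‖(∫ t in (-1 : ℝ)..1, f t) -
        ∑ x ∈ gaussLegendreNodes N, (gaussLegendreWeight N x : ℂ) * f x‖ ≤
      64 * (∫ θ in (0 : ℝ)..π, ‖F (k + 1) (Real.cos θ)‖) /
        (15 * π * k * (2 * N - 1 - k : ℝ) ^ k) := by
  refine (norm_integral_sub_gaussLegendre_le_descFactorial_of_hasDerivAt hs hF0 hcont hder hint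
    hk hN).trans ?_
  have hV0 : 0 ≤ ∫ θ in (0 : ℝ)..π, ‖F (k + 1) (Real.cos θ)‖ :=
    intervalIntegral.integral_nonneg Real.pi_pos.le fun θ _ => norm_nonneg _
  have hkpos : (0 : ℝ) < k := by exact_mod_cast hk
  have hbase : (1 : ℝ) ≤ 2 * N - 1 - k := by
    have h : k + 2 ≤ 2 * N := by omega
    have h' : (k : ℝ) + 2 ≤ 2 * N := by exact_mod_cast h
    linarith
  have hpow : (2 * N - 1 - k : ℝ) ^ k ≤ ((2 * N - 1).descFactorial k : ℝ) := by
    have h1 := Nat.pow_sub_le_descFactorial (2 * N - 1) k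
    have h2 : (2 * N - 1 - k) ^ k ≤ (2 * N - 1 + 1 - k) ^ k := Nat.pow_le_pow_left (by omega) k
    have h3 : ((2 * N - 1 - k : ℕ) : ℝ) = 2 * N - 1 - k := by
      rw [Nat.cast_sub (by omega), Nat.cast_sub (by omega)]
      push_cast
      ring
    rw [← h3]
    exact_mod_cast h2.trans h1
  have hP : (0 : ℝ) < (2 * N - 1 - k : ℝ) ^ k := pow_pos (by linarith) k
  exact div_le_div_of_nonneg_left (by positivity)
    (mul_pos (mul_pos (mul_pos (by norm_num) Real.pi_pos) hkpos) hP)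
    (mul_le_mul_of_nonneg_left hpow (by positivity))

/-! ### Theorem 4.5 (4.13) on `[a, b]` -/

/-- **Trefethen 2008, Thm. 4.5 (4.13) on a general interval `[a, b]`** (affine transport
`t ↦ (b-a)/2 · t + (a+b)/2`): with nodes `(b-a)/2 · x + (a+b)/2`, weights `(b-a)/2 · w_x`,
`1 ≤ k ≤ 2N - 2`, and a derivative chain `F 0 = f, …, F (k+1)` on `[a, b]` (`F i` continuous on
`[a, b]`, `F (i+1) = (F i)'` on `(a, b)` off the countable set `s` for `i ≤ k`,
`θ ↦ F (k+1) ((b-a)/2 cos θ + (a+b)/2)` integrable on `[0, π]`):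
`‖∫_a^b f - Σ_x (b-a)/2 · w_x f((b-a)/2 · x + (a+b)/2)‖ ≤ (b-a)/2 · 64 V_g / (15 π k (2N-1-k)^k)`,
`V_g = ((b-a)/2)^{k+1} ∫_0^π |F (k+1) ((b-a)/2 cos θ + (a+b)/2)| dθ` (the `V` of the transplanted
integrand `g(t) = f((b-a)/2 · t + (a+b)/2)` on `[-1, 1]`). [cite: Trefethen2008, Thm. 4.5 (4.13)] -/
theorem norm_integral_sub_gaussLegendre_le_interval_of_hasDerivAt {f : ℝ → ℂ} {k : ℕ}
    {F : ℕ → ℝ → ℂ} {s : Set ℝ} {a b : ℝ} (hab : a < b) (hs : s.Countable) (hF0 : F 0 = f)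
    (hcont : ∀ i ≤ k, ContinuousOn (F i) (Icc a b))
    (hder : ∀ i ≤ k, ∀ x ∈ Ioo a b \ s, HasDerivAt (F i) (F (i + 1) x) x)
    (hint : IntervalIntegrable
      (fun θ : ℝ => F (k + 1) ((b - a) / 2 * Real.cos θ + (a + b) / 2)) volume 0 π)
    (hk : 1 ≤ k) {N : ℕ} (hN : k ≤ 2 * N - 2) :
    ‖(∫ t in a..b, f t) - ∑ x ∈ gaussLegendreNodes N,
        ((b - a) / 2 * gaussLegendreWeight N x : ℂ) * f ((b - a) / 2 * x + (a + b) / 2)‖ ≤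
      (b - a) / 2 * (64 * (((b - a) / 2) ^ (k + 1) *
          ∫ θ in (0 : ℝ)..π, ‖F (k + 1) ((b - a) / 2 * Real.cos θ + (a + b) / 2)‖) /
        (15 * π * k * (2 * N - 1 - k : ℝ) ^ k)) := by
  subst hF0
  set L : ℝ := (b - a) / 2 with hL
  set c : ℝ := (a + b) / 2 with hc
  have hL0 : 0 < L := by rw [hL]; linarith
  have hLc : (L : ℂ) ≠ 0 := by exact_mod_cast hL0.ne'
  -- the transplanted chain `G i (t) = L^i F i (L t + c)` on `[-1, 1]`
  set G : ℕ → ℝ → ℂ := fun i t => ((L ^ i : ℝ) : ℂ) * F i (L * t + c) with hG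
  have hIcc : ∀ t ∈ Icc (-1 : ℝ) 1, L * t + c ∈ Icc a b := by
    intro t ht
    rw [hL, hc]
    constructor <;> nlinarith [ht.1, ht.2]
  have hIoo : ∀ t ∈ Ioo (-1 : ℝ) 1, L * t + c ∈ Ioo a b := by
    intro t ht
    rw [hL, hc]
    constructor <;> nlinarith [ht.1, ht.2]
  -- exceptional set pulled back by the affine map
  set s' : Set ℝ := (fun x => (x - c) / L) '' s with hs'
  have hs'c : s'.Countable := hs.image _
  have hGcont : ∀ i ≤ k, ContinuousOn (G i) (Icc (-1 : ℝ) 1) := by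
    intro i hi
    exact continuousOn_const.mul
      ((hcont i hi).comp (by fun_prop : Continuous fun t : ℝ => L * t + c).continuousOn hIcc)
  have hGder : ∀ i ≤ k, ∀ t ∈ Ioo (-1 : ℝ) 1 \ s', HasDerivAt (G i) (G (i + 1) t) t := by
    rintro i hi t ⟨ht, hts⟩
    have hmem : L * t + c ∈ Ioo a b \ s := by
      refine ⟨hIoo t ht, fun h => hts ⟨L * t + c, h, ?_⟩⟩
      field_simp
      ring
    have hlin : HasDerivAt (fun t : ℝ => L * t + c) L t := by
      simpa using ((hasDerivAt_id' t).const_mul L).add_const c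
    have h := ((hder i hi _ hmem).scomp t hlin).const_mul ((L ^ i : ℝ) : ℂ)
    refine h.congr_deriv ?_
    simp only [hG, Complex.real_smul]
    push_cast
    ring
  have hGint : IntervalIntegrable (fun θ : ℝ => G (k + 1) (Real.cos θ)) volume 0 π := by
    simp only [hG]
    exact hint.const_mul _
  have key := norm_integral_sub_gaussLegendre_le_of_hasDerivAt (F := G) hs'c rfl hGcont hGder
    hGint hk hN
  have hVG : (∫ θ in (0 : ℝ)..π, ‖G (k + 1) (Real.cos θ)‖) =
      L ^ (k + 1) * ∫ θ in (0 : ℝ)..π, ‖F (k + 1) (L * Real.cos θ + c)‖ := by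
    simp only [hG]
    rw [← intervalIntegral.integral_const_mul]
    refine intervalIntegral.integral_congr fun θ _ => ?_
    rw [norm_mul, Complex.norm_real, Real.norm_of_nonneg (pow_nonneg hL0.le _)]
  rw [hVG] at key
  have hG0 : ∀ t : ℝ, G 0 t = F 0 (L * t + c) := by
    intro t
    simp [hG]
  -- the affine change of variables in the integral and in the sum
  have hint2 : (∫ t in a..b, F 0 t) = (L : ℂ) * ∫ t in (-1 : ℝ)..1, G 0 t := by
    have h := intervalIntegral.integral_comp_mul_add (fun t : ℝ => F 0 t) hL0.ne' c
      (a := -1) (b := 1)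
    beta_reduce at h
    rw [show L * (-1 : ℝ) + c = a by rw [hL, hc]; ring,
      show L * (1 : ℝ) + c = b by rw [hL, hc]; ring] at h
    simp_rw [hG0]
    rw [h, Complex.real_smul, Complex.ofReal_inv, mul_inv_cancel_left₀ hLc]
  have hsum2 : ∑ x ∈ gaussLegendreNodes N,
      ((b - a) / 2 * gaussLegendreWeight N x : ℂ) * F 0 ((b - a) / 2 * x + (a + b) / 2) =
        (L : ℂ) * ∑ x ∈ gaussLegendreNodes N, (gaussLegendreWeight N x : ℂ) * G 0 x := by
    rw [Finset.mul_sum]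
    refine Finset.sum_congr rfl fun x _ => ?_
    rw [hG0, hL, hc]
    push_cast
    ring
  rw [hint2, hsum2, ← mul_sub, norm_mul, Complex.norm_real, Real.norm_of_nonneg hL0.le]
  exact mul_le_mul_of_nonneg_left key hL0.le

/-- **Trefethen 2008, Thm. 4.5 (4.13) on `[a, b]` for `f ∈ C^{k+1}(ℝ)`** with
`|f^{(k+1)}(x)| ≤ S` on `[a, b]` and `1 ≤ k ≤ 2N - 2`: since then
`V_g ≤ ((b-a)/2)^{k+1} · π S`,
`‖∫_a^b f - Σ_x (b-a)/2 · w_x f((b-a)/2 · x + (a+b)/2)‖ ≤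
  (b-a)/2 · 64 (π ((b-a)/2)^{k+1} S) / (15 π k (2N-1-k)^k)`.
[cite: Trefethen2008, Thm. 4.5 (4.13)] -/
theorem norm_integral_sub_gaussLegendre_le_interval_of_contDiff {f : ℝ → ℂ} {k : ℕ}
    {a b S : ℝ} (hab : a < b) (hf : ContDiff ℝ (k + 1 : ℕ) f)
    (hS : ∀ x ∈ Icc a b, ‖iteratedDeriv (k + 1) f x‖ ≤ S) (hk : 1 ≤ k) {N : ℕ}
    (hN : k ≤ 2 * N - 2) :
    ‖(∫ t in a..b, f t) - ∑ x ∈ gaussLegendreNodes N,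
        ((b - a) / 2 * gaussLegendreWeight N x : ℂ) * f ((b - a) / 2 * x + (a + b) / 2)‖ ≤
      (b - a) / 2 * (64 * (π * ((b - a) / 2) ^ (k + 1) * S) /
        (15 * π * k * (2 * N - 1 - k : ℝ) ^ k)) := by
  have hL0 : 0 < (b - a) / 2 := by linarith
  have hmaps : ∀ θ : ℝ, (b - a) / 2 * Real.cos θ + (a + b) / 2 ∈ Icc a b := by
    intro θ
    constructor <;> nlinarith [Real.neg_one_le_cos θ, Real.cos_le_one θ]
  have hFc : ∀ i ≤ k + 1, Continuous (iteratedDeriv i f) := fun i hi =>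
    hf.continuous_iteratedDeriv i (by exact_mod_cast hi)
  have hcomp : Continuous fun θ : ℝ =>
      iteratedDeriv (k + 1) f ((b - a) / 2 * Real.cos θ + (a + b) / 2) :=
    (hFc (k + 1) le_rfl).comp (by fun_prop)
  have key := norm_integral_sub_gaussLegendre_le_interval_of_hasDerivAt
    (F := fun i => iteratedDeriv i f) (s := ∅) hab Set.countable_empty iteratedDeriv_zero
    (fun i hi => (hFc i (by omega)).continuousOn)
    (fun i hi x _ => by
      have hd := hf.differentiable_iteratedDeriv i (by exact_mod_cast (show i < k + 1 by omega))
      rw [iteratedDeriv_succ]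
      exact (hd x).hasDerivAt)
    (hcomp.intervalIntegrable _ _) hk hN
  refine key.trans ?_
  have hI : (∫ θ in (0 : ℝ)..π,
      ‖iteratedDeriv (k + 1) f ((b - a) / 2 * Real.cos θ + (a + b) / 2)‖) ≤ π * S := by
    have h := intervalIntegral.integral_mono_on Real.pi_pos.le
      (hcomp.norm.intervalIntegrable 0 π)
      (intervalIntegrable_const : IntervalIntegrable (fun _ : ℝ => S) volume 0 π)
      fun θ _ => hS _ (hmaps θ)
    simpa [mul_comm] using h
  have hkpos : (0 : ℝ) < k := by exact_mod_cast hk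
  have hP : (0 : ℝ) < (2 * N - 1 - k : ℝ) ^ k := by
    apply pow_pos
    have h : k + 2 ≤ 2 * N := by omega
    have h' : (k : ℝ) + 2 ≤ 2 * N := by exact_mod_cast h
    linarith
  have hden : (0 : ℝ) < 15 * π * k * (2 * N - 1 - k : ℝ) ^ k :=
    mul_pos (mul_pos (mul_pos (by norm_num) Real.pi_pos) hkpos) hP
  have hnum : ((b - a) / 2) ^ (k + 1) *
      (∫ θ in (0 : ℝ)..π, ‖iteratedDeriv (k + 1) f ((b - a) / 2 * Real.cos θ + (a + b) / 2)‖) ≤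
        π * ((b - a) / 2) ^ (k + 1) * S := by
    have hLp : 0 ≤ ((b - a) / 2) ^ (k + 1) := pow_nonneg hL0.le _
    calc ((b - a) / 2) ^ (k + 1) *
          (∫ θ in (0 : ℝ)..π, ‖iteratedDeriv (k + 1) f ((b - a) / 2 * Real.cos θ + (a + b) / 2)‖)
        ≤ ((b - a) / 2) ^ (k + 1) * (π * S) := mul_le_mul_of_nonneg_left hI hLp
      _ = π * ((b - a) / 2) ^ (k + 1) * S := by ring
  exact mul_le_mul_of_nonneg_left
    (div_le_div_of_nonneg_right (mul_le_mul_of_nonneg_left hnum (by norm_num)) hden.le) hL0.le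

end Literature.Analysis.Quadrature
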